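import Mathlib

/-!
# Route `FilamentSkeletonRss` · crux `TransverseReduction1AG` (stmt-NavierStokesRegularity-27853) · line `defect_column_gate_1AG` —
# sectional blocks of S2a-loc `WaistColumnGateLoc1A`: the MULTIPOLE IDENTITIES (compact support of the stream function kills every
# exterior harmonic moment of the vorticity; m = 0 is the zero-mass hypothesis of the radial block, m = 1 the stub's dipole clause)

Helper file (`--supports stmt-NavierStokesRegularity-27853 --as helper`; seat ns-filament-s2aloc-p1 g0, the S2a-loc scan seat of MINT req187 /
dss_108 (C)).  Vocabulary: the frozen sectional operator of `colForceVort_eq` (`Theorems/…ColumnVorticity.lean`) acting on a horizontal,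
axially constant field `W = d × ∇Ψ`; in polar coordinates `(r, θ)` of the section the `m`-th Fourier coefficient `ψ` of the stream function `Ψ`
carries the vorticity coefficient `ω_m = ψ″ + ψ′/r − m²ψ/r²`, and the EXTERIOR HARMONIC MOMENT of order `m` of the vorticity is
`M_m = ∫₀^R r^{m+1} ω_m(r) dr` (the coefficient of `r^{−m} e^{imθ}` in the Biot–Savart potential outside the support; `m = 0` is the sectional
mass, `m = 1` the sectional dipole = the stub's first-moment clause).

THE IDENTITY (`multipole_flux_hasDerivAt`; no new definitions, the flux `F_m` and the density are written out).  `r^{m+1} ω_m = (r^{m+1} ψ′ − m r^m ψ)′` — a total derivative, for every `m : ℕ` (polynomial form,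
no division: `r^{m+1}ψ″ + r^m ψ′ − m² r^{m−1} ψ`).  Consequences (`exterior_multipole_eq_zero`, `sectional_mass_eq_zero`,
`sectional_dipole_eq_zero`): if `ψ′` vanishes at `R` and (`m = 0` or `ψ(R) = 0`) — in particular whenever `Ψ` is constant outside the sectional
disc of radius `R`, i.e. whenever `W` VANISHES outside the cylinder, which is exactly the localisation clause of `WaistColumnGateLoc1A` — then
`M_m = 0` for EVERY `m`.  So in the class of the stub: (i) the sectional mass vanishes (this DISCHARGES the hypothesis `hmass` of the kernel-checked
m = 0 block `radialBlock_apriori`, see `radialBlock_mass_of_streamCoeff`: the `u = r²` form `∫₀^{R²} w = 0`); (ii) the dipole clause of the stub is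
automatic for horizontal fields (LEAD note L1); (iii) for `m ≥ 2` the moments vanish as well — the «multipole lever»: it is what separates the
stub's class from the slow zero-mass EXCHANGE modes of the frozen operator in the counter-rotating part of the parameter box (three-sink sectional
base flow; kit j316860/j317115 of this seat, PREREG ee7f11457755fc66: exchange eigenvalues `0.0445 / 0.0241` at `Rc = 400`, Kramers-small in `Rc`,
with quadrupole cancellation ratio `≈ 0.73`, i.e. `M₂ ≠ 0` — inadmissible precisely by (iii)).  Any proof of S2a-loc that is uniform over the box
must use (iii), not only (i)+(ii): in that sub-box there is no spectral gap on zero-mass, zero-dipole data.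

All statements are one-variable real analysis (FTC on `[0, R]`); the radial coefficient `ψ` of a `C⁴` stream function is smooth on `ℝ` (extend by
parity), so two-sided derivatives at `0` and at `R` are the natural hypotheses.  HONEST FRAMING: elementary identities about ONE linear MODEL
operator of a hypothetical blow-up route (MODEL rung, negative side); `WaistColumnGateLoc1A` and `TransverseReduction1AG` are neither proved nor
refuted here; nothing in this file bears on Navier–Stokes regularity.
-/

set_option linter.dupNamespace false

noncomputable section

namespace Summit.NavierStokesRegularity.NavierStokesRegularity.Theorems.DefectColumnGate

open scoped Topology
open Set Filter MeasureTheory intervalIntegral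

/-! ## 1. The flux identity `r^{m+1} ω_m = (r^{m+1} ψ′ − m r^m ψ)′` -/

/-- **Flux identity.**  If `ψ′ = ψ₁` and `ψ₁′ = ψ₂` at `r`, then `F_m′(r) = r^{m+1}ψ₂ + r^m ψ₁ − m² r^{m−1} ψ`, i.e. `(r^{m+1}ψ′ − m r^m ψ)′ =
r^{m+1} ω_m`.  Pure calculus (product rule); valid at every real `r`, including `r = 0` and for `m = 0`. -/
theorem multipole_flux_hasDerivAt (m : ℕ) {ψ ψ₁ ψ₂ : ℝ → ℝ} {r : ℝ}
    (h₁ : HasDerivAt ψ (ψ₁ r) r) (h₂ : HasDerivAt ψ₁ (ψ₂ r) r) :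
    HasDerivAt (fun s : ℝ => s ^ (m + 1) * ψ₁ s - (m : ℝ) * (s ^ m * ψ s))
      (r ^ (m + 1) * ψ₂ r + r ^ m * ψ₁ r - (m : ℝ) ^ 2 * r ^ (m - 1) * ψ r) r := by
  have hA : HasDerivAt (fun s : ℝ => s ^ (m + 1) * ψ₁ s) (((m + 1 : ℕ) : ℝ) * r ^ (m + 1 - 1) * ψ₁ r + r ^ (m + 1) * ψ₂ r) r :=
    (hasDerivAt_pow (m + 1) r).mul h₂
  have hB : HasDerivAt (fun s : ℝ => (m : ℝ) * (s ^ m * ψ s)) ((m : ℝ) * ((m : ℝ) * r ^ (m - 1) * ψ r + r ^ m * ψ₁ r)) r :=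
    ((hasDerivAt_pow m r).mul h₁).const_mul (m : ℝ)
  have h := hA.sub hB
  refine h.congr_deriv ?_
  simp only [Nat.add_sub_cancel, Nat.cast_add, Nat.cast_one]
  ring

/-- The polynomial form IS `r^{m+1} ω_m` away from the axis: for `r ≠ 0`,
`r^{m+1}ψ₂ + r^m ψ₁ − m² r^{m−1}ψ = r^{m+1} (ψ₂ + ψ₁/r − m² ψ/r²)`. -/
theorem multipoleDensity_eq_mul_vorticity (m : ℕ) (ψ ψ₁ ψ₂ : ℝ → ℝ) {r : ℝ} (hr : r ≠ 0) :
    r ^ (m + 1) * ψ₂ r + r ^ m * ψ₁ r - (m : ℝ) ^ 2 * r ^ (m - 1) * ψ r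
      = r ^ (m + 1) * (ψ₂ r + ψ₁ r / r - (m : ℝ) ^ 2 * ψ r / r ^ 2) := by
  rcases Nat.eq_zero_or_pos m with hm | hm
  · subst hm
    simp
    field_simp
  · obtain ⟨k, rfl⟩ := Nat.exists_eq_add_of_le hm
    simp only [Nat.add_sub_cancel_left, pow_succ, Nat.cast_add, Nat.cast_one]
    field_simp
    ring

/-! ## 2. Compact support of the stream function kills every exterior moment -/

/-- **Exterior multipole moments vanish.**  On `[0, R]` let `ψ′ = ψ₁`, `ψ₁′ = ψ₂` (two-sided derivatives, as for the radial coefficient of a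
smooth function extended by parity), `ψ₂` continuous; if `ψ₁(R) = 0` and `m·ψ(R) = 0` (both hold when the stream function is constant beyond
`R`, i.e. when `W = d × ∇Ψ` vanishes outside the sectional cylinder of radius `R`, after subtracting that constant for `m = 0`), then
`∫₀^R r^{m+1} ω_m = ∫₀^R (r^{m+1}ψ″ + r^m ψ′ − m² r^{m−1}ψ) dr = 0`.  The flux vanishes at `r = 0` for free (`0^{m+1} = 0`, and `m·0^m = 0`). -/
theorem exterior_multipole_eq_zero (m : ℕ) {R : ℝ} (hR : 0 ≤ R) {ψ ψ₁ ψ₂ : ℝ → ℝ}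
    (h₁ : ∀ r ∈ Icc 0 R, HasDerivAt ψ (ψ₁ r) r) (h₂ : ∀ r ∈ Icc 0 R, HasDerivAt ψ₁ (ψ₂ r) r)
    (hψ₂ : ContinuousOn ψ₂ (Icc 0 R)) (hR₁ : ψ₁ R = 0) (hR₀ : (m : ℝ) * ψ R = 0) :
    ∫ r in (0:ℝ)..R, (r ^ (m + 1) * ψ₂ r + r ^ m * ψ₁ r - (m : ℝ) ^ 2 * r ^ (m - 1) * ψ r) = 0 := by
  have hIcc : uIcc 0 R = Icc 0 R := uIcc_of_le hR
  have hderiv : ∀ r ∈ uIcc 0 R, HasDerivAt (fun s : ℝ => s ^ (m + 1) * ψ₁ s - (m : ℝ) * (s ^ m * ψ s))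
      ((fun r : ℝ => r ^ (m + 1) * ψ₂ r + r ^ m * ψ₁ r - (m : ℝ) ^ 2 * r ^ (m - 1) * ψ r) r) r := by
    intro r hr
    rw [hIcc] at hr
    exact multipole_flux_hasDerivAt m (h₁ r hr) (h₂ r hr)
  -- continuity of `ψ`, `ψ₁` on `[0,R]` from differentiability
  have hψc : ContinuousOn ψ (Icc 0 R) := fun r hr => (h₁ r hr).continuousAt.continuousWithinAt
  have hψ₁c : ContinuousOn ψ₁ (Icc 0 R) := fun r hr => (h₂ r hr).continuousAt.continuousWithinAt
  have hcont : ContinuousOn (fun r : ℝ => r ^ (m + 1) * ψ₂ r + r ^ m * ψ₁ r - (m : ℝ) ^ 2 * r ^ (m - 1) * ψ r) (uIcc 0 R) := by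
    rw [hIcc]
    fun_prop
  rw [integral_eq_sub_of_hasDerivAt hderiv hcont.intervalIntegrable]
  -- both endpoint values of the flux vanish
  have hRval : (fun s : ℝ => s ^ (m + 1) * ψ₁ s - (m : ℝ) * (s ^ m * ψ s)) R = 0 := by
    simp only []
    rw [hR₁, mul_zero, zero_sub, neg_eq_zero, mul_comm (R ^ m) (ψ R), ← mul_assoc, hR₀, zero_mul]
  have h0val : (fun s : ℝ => s ^ (m + 1) * ψ₁ s - (m : ℝ) * (s ^ m * ψ s)) 0 = 0 := by
    simp only []
    rcases Nat.eq_zero_or_pos m with hm | hm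
    · subst hm; simp
    · simp [zero_pow (Nat.pos_iff_ne_zero.mp hm), zero_pow (Nat.succ_ne_zero m)]
  simp only [] at hRval h0val ⊢
  rw [hRval, h0val, sub_zero]

/-- **m = 0: the sectional MASS of the vorticity of a compactly supported horizontal field vanishes.**  `∫₀^R (r ψ″ + ψ′) dr = 0`
(`r ω₀ = (r ψ′)′`), under `ψ′(R) = 0` only. -/
theorem sectional_mass_eq_zero {R : ℝ} (hR : 0 ≤ R) {ψ ψ₁ ψ₂ : ℝ → ℝ}
    (h₁ : ∀ r ∈ Icc 0 R, HasDerivAt ψ (ψ₁ r) r) (h₂ : ∀ r ∈ Icc 0 R, HasDerivAt ψ₁ (ψ₂ r) r)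
    (hψ₂ : ContinuousOn ψ₂ (Icc 0 R)) (hR₁ : ψ₁ R = 0) :
    ∫ r in (0:ℝ)..R, (r * ψ₂ r + ψ₁ r) = 0 := by
  have h := exterior_multipole_eq_zero 0 hR h₁ h₂ hψ₂ hR₁ (by simp)
  have hcongr : ∀ r ∈ uIcc 0 R, (r ^ (0 + 1) * ψ₂ r + r ^ 0 * ψ₁ r - ((0:ℕ) : ℝ) ^ 2 * r ^ (0 - 1) * ψ r) = r * ψ₂ r + ψ₁ r := by
    intro r _
    simp
  rwa [integral_congr hcongr] at h

/-- **m = 1: the sectional DIPOLE moment vanishes** — the stub's first-moment clause is automatic for horizontal compactly supported fields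
(LEAD note L1): `∫₀^R (r² ψ″ + r ψ′ − ψ) dr = 0` (`r² ω₁ = (r² ψ′ − r ψ)′`), under `ψ′(R) = 0 = ψ(R)`. -/
theorem sectional_dipole_eq_zero {R : ℝ} (hR : 0 ≤ R) {ψ ψ₁ ψ₂ : ℝ → ℝ}
    (h₁ : ∀ r ∈ Icc 0 R, HasDerivAt ψ (ψ₁ r) r) (h₂ : ∀ r ∈ Icc 0 R, HasDerivAt ψ₁ (ψ₂ r) r)
    (hψ₂ : ContinuousOn ψ₂ (Icc 0 R)) (hR₁ : ψ₁ R = 0) (hR₀ : ψ R = 0) :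
    ∫ r in (0:ℝ)..R, (r ^ 2 * ψ₂ r + r * ψ₁ r - ψ r) = 0 := by
  have h := exterior_multipole_eq_zero 1 hR h₁ h₂ hψ₂ hR₁ (by simp [hR₀])
  have hcongr : ∀ r ∈ uIcc 0 R, (r ^ (1 + 1) * ψ₂ r + r ^ 1 * ψ₁ r - ((1:ℕ) : ℝ) ^ 2 * r ^ (1 - 1) * ψ r) = r ^ 2 * ψ₂ r + r * ψ₁ r - ψ r := by
    intro r _
    simp
  rwa [integral_congr hcongr] at h

/-- **m ≥ 1, general: the exterior harmonic moment of order `m` vanishes** under `ψ′(R) = 0 = ψ(R)` — the multipole lever (for `m = 2`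
this is the quadrupole condition that the slow exchange modes of the three-sink sub-box violate). -/
theorem exterior_multipole_eq_zero_of_vanishing (m : ℕ) {R : ℝ} (hR : 0 ≤ R) {ψ ψ₁ ψ₂ : ℝ → ℝ}
    (h₁ : ∀ r ∈ Icc 0 R, HasDerivAt ψ (ψ₁ r) r) (h₂ : ∀ r ∈ Icc 0 R, HasDerivAt ψ₁ (ψ₂ r) r)
    (hψ₂ : ContinuousOn ψ₂ (Icc 0 R)) (hR₁ : ψ₁ R = 0) (hR₀ : ψ R = 0) :
    ∫ r in (0:ℝ)..R, (r ^ (m + 1) * ψ₂ r + r ^ m * ψ₁ r - (m : ℝ) ^ 2 * r ^ (m - 1) * ψ r) = 0 :=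
  exterior_multipole_eq_zero m hR h₁ h₂ hψ₂ hR₁ (by simp [hR₀])

/-! ## 3. The dictionary to the m = 0 radial block (`u = r²`): compact support discharges `hmass` of `radialBlock_apriori` -/

/-- **Zero sectional mass in the variable `u = r²`.**  If `w` (the radial vorticity profile written in `u = r²`, as in `radialBlock_apriori`)
satisfies `w(r²) = ψ″(r) + ψ′(r)/r` for `0 < r ≤ R`, is continuous on `[0, R²]`, and the stream coefficient has `ψ′(0) = 0` (parity of the
`m = 0` coefficient) and `ψ′(R) = 0` (compact support of `W`), then `∫₀^{R²} w(u) du = 0` — the hypothesis `hmass` of the m = 0 block with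
`U = R²`.  (Substitution `u = r²`, `du = 2r dr`, then `sectional_mass_eq_zero`.) -/
theorem radialBlock_mass_of_streamCoeff {R : ℝ} (hR : 0 ≤ R) {ψ ψ₁ ψ₂ w : ℝ → ℝ}
    (h₁ : ∀ r ∈ Icc 0 R, HasDerivAt ψ (ψ₁ r) r) (h₂ : ∀ r ∈ Icc 0 R, HasDerivAt ψ₁ (ψ₂ r) r)
    (hψ₂ : ContinuousOn ψ₂ (Icc 0 R)) (hψ₁0 : ψ₁ 0 = 0) (hR₁ : ψ₁ R = 0)
    (hw : ContinuousOn w (Icc 0 (R ^ 2))) (hwr : ∀ r ∈ Ioc 0 R, w (r ^ 2) = ψ₂ r + ψ₁ r / r) :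
    ∫ u in (0:ℝ)..R ^ 2, w u = 0 := by
  -- substitution u = r² on [0, R]
  have hIcc : uIcc 0 R = Icc 0 R := uIcc_of_le hR
  have himage : (fun r : ℝ => r ^ 2) '' uIcc 0 R ⊆ Icc 0 (R ^ 2) := by
    rw [hIcc]
    rintro _ ⟨r, hr, rfl⟩
    exact ⟨by positivity, pow_le_pow_left₀ hr.1 hr.2 2⟩
  have hsub : ∫ r in (0:ℝ)..R, (w ∘ fun r => r ^ 2) r * (2 * r) = ∫ u in ((0:ℝ) ^ 2)..R ^ 2, w u := by
    apply integral_comp_mul_deriv' (f := fun r : ℝ => r ^ 2) (f' := fun r => 2 * r)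
    · intro r _
      simpa using hasDerivAt_pow 2 r
    · exact (continuous_const.mul continuous_id).continuousOn
    · exact hw.mono himage
  rw [zero_pow two_ne_zero] at hsub
  rw [← hsub]
  -- the integrand equals 2 (r ψ₂ + ψ₁) on [0, R]
  have hψ₁c : ContinuousOn ψ₁ (Icc 0 R) := fun r hr => (h₂ r hr).continuousAt.continuousWithinAt
  have hcongr : ∀ r ∈ uIcc 0 R, (w ∘ fun r => r ^ 2) r * (2 * r) = 2 * (r * ψ₂ r + ψ₁ r) := by
    intro r hr
    rw [hIcc] at hr
    rcases eq_or_lt_of_le hr.1 with h0 | hpos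
    · subst h0; simp [hψ₁0]
    · have hr' : r ∈ Ioc 0 R := ⟨hpos, hr.2⟩
      simp only [Function.comp]
      rw [hwr r hr']
      field_simp
  rw [integral_congr hcongr, intervalIntegral.integral_const_mul, sectional_mass_eq_zero hR h₁ h₂ hψ₂ hR₁, mul_zero]

end Summit.NavierStokesRegularity.NavierStokesRegularity.Theorems.DefectColumnGate

end
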